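import Summits.QuantumFields.YangMills.Theorems.SwapVirialDeficitSwapRingDeficitMomentsWindow
import Summits.QuantumFields.YangMills.Theorems.SwapTwistDeficitPeriodicRingFloorSharp
import HarnessLib

/-!
# The PERIODIC ring: window-uniform a-priori ceiling on the principal-sector mean deficit and ALL Gibbs moments at scale `L⁴·log b ∕ b`
# (free-hands support of ⟨stmt-QuantumFields-24196⟩ `SwapVirialDeficit.ToronSoftnessSharp`; the periodic twin of ✓`…SwapRingDeficitMoments`, as LEAD
# ym-line-sfw-p2 g96 asked, memo2-24196-uniformity-census §3 / ym-idea-1 STATUS 15:17:57Z)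

`F₀ = RingDeficit.ringDeficit L 0` is the action deficit of the PERIODIC `2L`-slice zero-flux ring (principal electric-flux sector), `μ_L = ringMeasure L`,
`W₀(b) = e^{12bL⁴}·∫ e^{−bF₀} dμ_L` its sector weight.  Nothing window-uniform about its Gibbs law was in the tree; this file supplies the crude but
UNIFORM-IN-`L` thermodynamics, verbatim the σ-ring chain (w2 g57 ✓`swap_meanDeficit_apriori` + this seat's generic tilting lemmas):

* §1 ★★ `periodic_laplace_floor_uniform` — ABSOLUTE `K ≥ 0`: `exp(−((9L⁴ − 3/2)·log b + K·L⁴·(1 + log L))) ≤ ∫ e^{−bF₀} dμ_L` for EVERY `L ≥ 1`, `b ≥ 1`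
  (w3 g61's explicit ✓`PeriodicRingFloor.sharp_laplace_floor`, logarithm taken);
* §2 ★★★ `periodic_meanDeficit_apriori` — `b·⟨F₀⟩_b ≤ 2(9L⁴ − 3/2)·log b + 2K·L⁴·(1 + log L)` for EVERY `L`, `b ≥ 1` (thermodynamic sandwich
  ✓`mul_gibbsMean_le_of_laplace_floor`);
* §3 ★★★ `periodic_deficit_rpow_moment_le` — ABSOLUTE `C > 0`: for EVERY `L`, `b ≥ 2`, `p > 0`,
  `∫ F₀^p e^{−bF₀} dμ_L ≤ e·(C·p·L⁴·(1 + log L + log b)/b)^p·∫ e^{−bF₀} dμ_L` (✓`integral_rpow_mul_exp_neg_le_of_apriori`): the periodic Gibbs law of the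
  deficit is concentrated at scale `L⁴ log b ∕ b` with super-polynomial tails, uniformly in `L`; ★★ `periodic_deficit_sq_moment_le`,
  ★★ `periodic_deficit_threeHalves_moment_le` (`b·∫F₀^{3/2}e^{−bF₀} ≤ C(L⁴ℓ)^{3/2} b^{−1/2} Z₀`), ★ `periodic_deficit_gibbs_tail_le` (Chebyshev),
  ★★ `periodic_deficit_threeHalves_window` (ε-form on `L ≤ b^a`, ✓`window_pow_mul_rpow_le`).
These are inputs of the kind memo2-24196 §3 asks for (fibrewise high-dimensional Laplace needs a-priori localisation of the Gibbs law at the right scale,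
uniformly in `L`); they are NOT rates for the fixed-`L` chain and prove nothing about the window statement itself.

HONEST LABEL: crude window-uniform bookkeeping (a-priori scale `2 log b ×` the true `(9L⁴ − 3/2)/b`); ⟨24196⟩ `ToronSoftnessSharp` (window-uniform) ∕ ⟨24197⟩ ∕
⟨24194⟩ ∕ ⟨24497⟩ OPEN; own crux ⟨22884⟩ OPEN (blocked-on ⟨19935⟩); no crux, rung of record or summit is proved; the Yang–Mills mass gap is NOT proved; no summit
is proved by a line.  THEOREMS ONLY (0 `def`, 0 `sorry`), standard axioms.  Width seat ym-line-sfw-p2-w3 g65 (cell ym-idea-1, free hands),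
`--supports stmt-QuantumFields-24196`.  References: [cite: Griffiths1964]; [cite: Luscher1983, §2]; [cite: Vanbaal2001]; [folklore].
-/

set_option autoImplicit false

noncomputable section

open MeasureTheory Set Filter
open scoped BigOperators Topology
open Literature.MathematicalPhysics.QuantumFieldTheory hiding SU2
open Literature.MathematicalPhysics.QuantumLattice

namespace Summit.QuantumFields.YangMills.Theorems.SwapVirialDeficit.PeriodicRing

open Summit.QuantumFields.YangMills.Theorems.FemtoTransferGap
open Summit.QuantumFields.YangMills.Theorems.VirialFluxGap.RingDeficit
open Summit.QuantumFields.YangMills.Theorems.SwapTwistDeficit.PeriodicRingFloor (sharp_laplace_floor)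
open Summit.QuantumFields.YangMills.Theorems.SwapVirialDeficit.SwapRing (mul_gibbsMean_le_of_laplace_floor integral_rpow_mul_exp_neg_le_of_apriori
  window_pow_mul_rpow_le)

/-! ## §1 The explicit window-uniform Laplace floor, logarithmic form -/

/-- Arithmetic of the floor constant: for `L ≥ 1`, `b ≥ 1`,
`−log(e^{−1}·((1/34)^{6L⁴+1}·(400L⁴b)^{−(9L⁴−3/2)})) ≤ (9L⁴ − 3/2)·log b + (1 + 7·log 34 + 9·log 400 + 36)·L⁴·(1 + log L)`. [folklore] -/
theorem neg_log_periodic_floor_le {L : ℕ} [NeZero L] {b : ℝ} (hb : 1 ≤ b) :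
    -Real.log (Real.exp (-1) * ((1 / 34 : ℝ) ^ (6 * L ^ 4 + 1) * (400 * (L : ℝ) ^ 4 * b) ^ (-(9 * (L : ℝ) ^ 4 - 3 / 2)))) ≤
      (9 * (L : ℝ) ^ 4 - 3 / 2) * Real.log b + (1 + 7 * Real.log 34 + 9 * Real.log 400 + 36) * (L : ℝ) ^ 4 * (1 + Real.log L) := by
  have hL : (1 : ℝ) ≤ L := by exact_mod_cast NeZero.one_le
  have hL0 : (0 : ℝ) < L := by linarith
  have hL4 : (1 : ℝ) ≤ (L : ℝ) ^ 4 := one_le_pow₀ hL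
  have hlogL : 0 ≤ Real.log L := Real.log_nonneg hL
  have hlogb : 0 ≤ Real.log b := Real.log_nonneg hb
  have h34 : 0 < Real.log 34 := Real.log_pos (by norm_num)
  have h400 : 0 < Real.log 400 := Real.log_pos (by norm_num)
  have hKb : 0 < 400 * (L : ℝ) ^ 4 * b := by positivity
  have hcast : ((6 * L ^ 4 + 1 : ℕ) : ℝ) = 6 * (L : ℝ) ^ 4 + 1 := by push_cast; ring
  rw [Real.log_mul (Real.exp_pos _).ne' (by positivity), Real.log_exp, Real.log_mul (by positivity) (by positivity), Real.log_pow, hcast,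
    Real.log_rpow hKb, Real.log_mul (by positivity) (by positivity), Real.log_mul (by norm_num) (by positivity), Real.log_pow, one_div, Real.log_inv]
  have hlogL4 : Real.log L ≤ (L : ℝ) ^ 4 * Real.log L := le_mul_of_one_le_left hlogL hL4
  have hL40 : (0 : ℝ) ≤ (L : ℝ) ^ 4 := zero_le_one.trans hL4
  push_cast
  nlinarith [mul_nonneg hL40 hlogL, mul_nonneg hL40 hlogb, mul_nonneg h34.le hL40, mul_nonneg h400.le hL40,
    mul_nonneg (mul_nonneg h400.le hL40) hlogL, mul_nonneg (mul_nonneg h34.le hL40) hlogL, hlogb, hlogL, h34, h400]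

/-- ★★ **WINDOW-UNIFORM EXPLICIT LAPLACE FLOOR OF THE PERIODIC PRINCIPAL DEFICIT**: there is an ABSOLUTE `K ≥ 0` with
`exp(−((9L⁴ − 3/2)·log b + K·L⁴·(1 + log L))) ≤ ∫ e^{−bF₀} dμ_L` for EVERY `L ≥ 1` and every `b ≥ 1` (✓`PeriodicRingFloor.sharp_laplace_floor`, logarithm taken).
[cite: Luscher1983, §2] [cite: Vanbaal2001] -/
theorem periodic_laplace_floor_uniform :
    ∃ K : ℝ, 0 ≤ K ∧ ∀ (L : ℕ) [NeZero L] (b : ℝ), 1 ≤ b →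
      Real.exp (-((9 * (L : ℝ) ^ 4 - 3 / 2) * Real.log b + K * (L : ℝ) ^ 4 * (1 + Real.log L))) ≤
        ∫ p, Real.exp (-b * ringDeficit L (fun _ => false) p) ∂(ringMeasure L) := by
  refine ⟨1 + 7 * Real.log 34 + 9 * Real.log 400 + 36, by have := Real.log_pos (by norm_num : (1:ℝ) < 34); have := Real.log_pos (by norm_num : (1:ℝ) < 400); positivity,
    fun L _ b hb => ?_⟩
  have hfloor := sharp_laplace_floor (L := L) hb
  have hK := neg_log_periodic_floor_le (L := L) hb
  have hL0 : (0 : ℝ) < L := by exact_mod_cast NeZero.pos L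
  have hb0 : 0 < b := by linarith
  have hKb : (0 : ℝ) < 400 * (L : ℝ) ^ 4 * b := by positivity
  have hpos : 0 < Real.exp (-1) * ((1 / 34 : ℝ) ^ (6 * L ^ 4 + 1) * (400 * (L : ℝ) ^ 4 * b) ^ (-(9 * (L : ℝ) ^ 4 - 3 / 2))) :=
    mul_pos (Real.exp_pos _) (mul_pos (pow_pos (by norm_num) _) (Real.rpow_pos_of_pos hKb _))
  calc Real.exp (-((9 * (L : ℝ) ^ 4 - 3 / 2) * Real.log b + (1 + 7 * Real.log 34 + 9 * Real.log 400 + 36) * (L : ℝ) ^ 4 * (1 + Real.log L)))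
      ≤ Real.exp (Real.log (Real.exp (-1) * ((1 / 34 : ℝ) ^ (6 * L ^ 4 + 1) * (400 * (L : ℝ) ^ 4 * b) ^ (-(9 * (L : ℝ) ^ 4 - 3 / 2))))) :=
        Real.exp_le_exp.2 (by linarith)
    _ = Real.exp (-1) * ((1 / 34 : ℝ) ^ (6 * L ^ 4 + 1) * (400 * (L : ℝ) ^ 4 * b) ^ (-(9 * (L : ℝ) ^ 4 - 3 / 2))) := Real.exp_log hpos
    _ ≤ ∫ p, Real.exp (-(b * ringDeficit L (fun _ => false) p)) ∂(ringMeasure L) := hfloor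
    _ = ∫ p, Real.exp (-b * ringDeficit L (fun _ => false) p) ∂(ringMeasure L) := by
        refine integral_congr_ae (ae_of_all _ fun p => ?_)
        show Real.exp (-(b * ringDeficit L (fun _ => false) p)) = Real.exp (-b * ringDeficit L (fun _ => false) p)
        rw [neg_mul]

/-! ## §2 The window-uniform a-priori ceiling on the periodic mean deficit -/

/-- ★★★ **WINDOW-UNIFORM A-PRIORI CEILING ON THE PERIODIC PRINCIPAL-SECTOR MEAN DEFICIT**: ABSOLUTE `K ≥ 0` such that for EVERY `L ≥ 1` and every `b ≥ 1`,
`b·⟨F₀⟩_b ≤ 2(9L⁴ − 3/2)·log b + K·L⁴·(1 + log L)`,  `⟨F₀⟩_b = ∫ F₀ e^{−bF₀} dμ_L ∕ ∫ e^{−bF₀} dμ_L`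
(thermodynamic sandwich ✓`mul_gibbsMean_le_of_laplace_floor` + `periodic_laplace_floor_uniform`).  The crux ⟨24196⟩ pins `b⟨F₀⟩_b` to `9L⁴ − 3/2 ± ε` on a window;
this is only the crude `O(L⁴ log b)` ceiling, but it holds uniformly in `L` with no window condition. [cite: Griffiths1964] [cite: Luscher1983, §2] -/
theorem periodic_meanDeficit_apriori :
    ∃ K : ℝ, 0 ≤ K ∧ ∀ (L : ℕ) [NeZero L] (b : ℝ), 1 ≤ b →
      b * ((∫ p, ringDeficit L (fun _ => false) p * Real.exp (-b * ringDeficit L (fun _ => false) p) ∂(ringMeasure L)) /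
          ∫ p, Real.exp (-b * ringDeficit L (fun _ => false) p) ∂(ringMeasure L)) ≤
        2 * (9 * (L : ℝ) ^ 4 - 3 / 2) * Real.log b + K * (L : ℝ) ^ 4 * (1 + Real.log L) := by
  obtain ⟨K, hK, hfloor⟩ := periodic_laplace_floor_uniform
  refine ⟨2 * K, by positivity, fun L _ b hb => ?_⟩
  haveI := isProbabilityMeasure_ringMeasure (L := L)
  have hb0 : 0 < b := by linarith
  obtain ⟨M, hM⟩ := exists_abs_ringDeficit_le (L := L) (fun _ => false)
  have h := mul_gibbsMean_le_of_laplace_floor (ringMeasure L) (measurable_ringDeficit _) hM (ringDeficit_nonneg (L := L) _) hb0 (hfloor L b hb)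
  linarith

/-! ## §3 All Gibbs moments of the periodic deficit, uniformly in `L` -/

/-- ★★★ **WINDOW-UNIFORM ALL-MOMENT BOUND FOR THE PERIODIC PRINCIPAL DEFICIT**: ABSOLUTE `C > 0` such that for EVERY `L ≥ 1`, every `b ≥ 2` and every real
`p > 0`,  `∫ F₀^p e^{−bF₀} dμ_L ≤ e · (C·p·L⁴·(1 + log L + log b)/b)^p · ∫ e^{−bF₀} dμ_L`  (`periodic_meanDeficit_apriori` fed into the generic
✓`integral_rpow_mul_exp_neg_le_of_apriori`): the periodic Gibbs law of the deficit is concentrated at scale `L⁴ log b ∕ b` with super-polynomial tails,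
uniformly in `L`. [cite: Griffiths1964] [cite: Luscher1983, §2] -/
theorem periodic_deficit_rpow_moment_le :
    ∃ C : ℝ, 0 < C ∧ ∀ (L : ℕ) [NeZero L] (b : ℝ), 2 ≤ b → ∀ p : ℝ, 0 < p →
      ∫ q, ringDeficit L (fun _ => false) q ^ p * Real.exp (-b * ringDeficit L (fun _ => false) q) ∂(ringMeasure L) ≤
        Real.exp 1 * (C * p * (L : ℝ) ^ 4 * (1 + Real.log L + Real.log b) / b) ^ p *
          ∫ q, Real.exp (-b * ringDeficit L (fun _ => false) q) ∂(ringMeasure L) := by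
  obtain ⟨K, hK, hap⟩ := periodic_meanDeficit_apriori
  refine ⟨2 * (19 + K), by positivity, fun L _ b hb p hp => ?_⟩
  haveI := isProbabilityMeasure_ringMeasure (L := L)
  obtain ⟨M, hM⟩ := exists_abs_ringDeficit_le (L := L) (fun _ => false)
  have hL : (1 : ℝ) ≤ L := by exact_mod_cast NeZero.one_le
  have hL4 : (1 : ℝ) ≤ (L : ℝ) ^ 4 := one_le_pow₀ hL
  have hlogL : 0 ≤ Real.log L := Real.log_nonneg hL
  have hb1 : 1 ≤ b := by linarith
  have hb0 : 0 < b := by linarith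
  have hlogb : 0 ≤ Real.log b := Real.log_nonneg hb1
  have hA : (0 : ℝ) ≤ 2 * (9 * (L : ℝ) ^ 4 - 3 / 2) := by nlinarith
  have hB : (0 : ℝ) ≤ K * (L : ℝ) ^ 4 * (1 + Real.log L) := by positivity
  have h := integral_rpow_mul_exp_neg_le_of_apriori (ringMeasure L) (measurable_ringDeficit _) hM (ringDeficit_nonneg (L := L) _) hA hB le_rfl
    (fun s hs => hap L s hs) (by linarith : 2 * (1 : ℝ) ≤ b) hp
  refine h.trans (mul_le_mul_of_nonneg_right (mul_le_mul_of_nonneg_left ?_ (by positivity)) (integral_nonneg fun q => (Real.exp_pos _).le))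
  have hD : 2 * (9 * (L : ℝ) ^ 4 - 3 / 2) * Real.log b + K * (L : ℝ) ^ 4 * (1 + Real.log L) + 1 ≤
      (19 + K) * (L : ℝ) ^ 4 * (1 + Real.log L + Real.log b) := by
    nlinarith [mul_nonneg (sub_nonneg.2 hL4) hlogb, mul_nonneg hK (mul_nonneg (zero_le_one.trans hL4) hlogb),
      mul_nonneg (zero_le_one.trans hL4) hlogL, mul_nonneg (zero_le_one.trans hL4) hlogb]
  have hnum : 0 ≤ 2 * p * (2 * (9 * (L : ℝ) ^ 4 - 3 / 2) * Real.log b + K * (L : ℝ) ^ 4 * (1 + Real.log L) + 1) / b := by positivity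
  refine Real.rpow_le_rpow hnum ?_ hp.le
  rw [div_le_div_iff_of_pos_right hb0]
  have : 2 * p * ((19 + K) * (L : ℝ) ^ 4 * (1 + Real.log L + Real.log b)) =
      2 * (19 + K) * p * (L : ℝ) ^ 4 * (1 + Real.log L + Real.log b) := by ring
  rw [← this]
  exact mul_le_mul_of_nonneg_left hD (by positivity)

/-- ★★ **PERIODIC SECOND MOMENT, UNIFORMLY IN `L`**: ABSOLUTE `C > 0` with `∫ F₀² e^{−bF₀} dμ_L ≤ C·L⁸·(1 + log L + log b)²/b² · ∫ e^{−bF₀} dμ_L`, every `L`, `b ≥ 2`.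
[cite: Griffiths1964] -/
theorem periodic_deficit_sq_moment_le :
    ∃ C : ℝ, 0 < C ∧ ∀ (L : ℕ) [NeZero L] (b : ℝ), 2 ≤ b →
      ∫ q, ringDeficit L (fun _ => false) q ^ 2 * Real.exp (-b * ringDeficit L (fun _ => false) q) ∂(ringMeasure L) ≤
        C * (L : ℝ) ^ 8 * (1 + Real.log L + Real.log b) ^ 2 / b ^ 2 * ∫ q, Real.exp (-b * ringDeficit L (fun _ => false) q) ∂(ringMeasure L) := by
  obtain ⟨C, hC, h⟩ := periodic_deficit_rpow_moment_le
  refine ⟨Real.exp 1 * (2 * C) ^ 2, by positivity, fun L _ b hb => ?_⟩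
  have h2 := h L b hb 2 (by norm_num)
  have e1 : ∀ q, ringDeficit L (fun _ => false) q ^ (2 : ℝ) = ringDeficit L (fun _ => false) q ^ 2 := fun q => Real.rpow_two _
  simp only [e1] at h2
  refine h2.trans (le_of_eq ?_)
  rw [Real.rpow_two]
  ring

/-- ★★ **PERIODIC `3/2`-MOMENT WITH THE COUPLING IN FRONT**: ABSOLUTE `C > 0` with, for EVERY `L` and `b ≥ 2`,
`b · ∫ F₀^{3/2} e^{−bF₀} dμ_L ≤ C · (L⁴·(1 + log L + log b))^{3/2} · b^{−1/2} · ∫ e^{−bF₀} dμ_L` — cubic Taylor remainders of the periodic virial ∕ Laplace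
expansions are `o(1)` in the mean on every window. [cite: Griffiths1964] [cite: Luscher1983, §2] -/
theorem periodic_deficit_threeHalves_moment_le :
    ∃ C : ℝ, 0 < C ∧ ∀ (L : ℕ) [NeZero L] (b : ℝ), 2 ≤ b →
      b * ∫ q, ringDeficit L (fun _ => false) q ^ ((3 : ℝ) / 2) * Real.exp (-b * ringDeficit L (fun _ => false) q) ∂(ringMeasure L) ≤
        C * ((L : ℝ) ^ 4 * (1 + Real.log L + Real.log b)) ^ ((3 : ℝ) / 2) * b ^ (-(1 : ℝ) / 2) *
          ∫ q, Real.exp (-b * ringDeficit L (fun _ => false) q) ∂(ringMeasure L) := by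
  obtain ⟨C, hC, h⟩ := periodic_deficit_rpow_moment_le
  refine ⟨Real.exp 1 * ((3 : ℝ) / 2 * C) ^ ((3 : ℝ) / 2), by positivity, fun L _ b hb => ?_⟩
  have h32 := h L b hb ((3 : ℝ) / 2) (by norm_num)
  have hb0 : 0 < b := by linarith
  have hL1 : (1 : ℝ) ≤ L := by exact_mod_cast NeZero.one_le
  have hℓ : 0 ≤ 1 + Real.log L + Real.log b := by
    have := Real.log_nonneg hL1; have := Real.log_nonneg (by linarith : (1:ℝ) ≤ b); linarith
  set X : ℝ := (L : ℝ) ^ 4 * (1 + Real.log L + Real.log b) with hX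
  have hX0 : 0 ≤ X := by positivity
  set Z : ℝ := ∫ q, Real.exp (-b * ringDeficit L (fun _ => false) q) ∂(ringMeasure L) with hZ
  have e1 : C * ((3 : ℝ) / 2) * (L : ℝ) ^ 4 * (1 + Real.log L + Real.log b) / b = ((3 : ℝ) / 2 * C) * X / b := by rw [hX]; ring
  rw [e1] at h32
  have e2 : b * (((3 : ℝ) / 2 * C) * X / b) ^ ((3 : ℝ) / 2) = ((3 : ℝ) / 2 * C) ^ ((3 : ℝ) / 2) * X ^ ((3 : ℝ) / 2) * b ^ (-(1 : ℝ) / 2) := by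
    rw [Real.div_rpow (by positivity) hb0.le, Real.mul_rpow (by positivity) hX0]
    have hb32 : b ^ ((3 : ℝ) / 2) = b * b ^ ((1 : ℝ) / 2) := by
      rw [show ((3 : ℝ) / 2) = 1 + 1 / 2 by norm_num, Real.rpow_add hb0, Real.rpow_one]
    have hbneg : b ^ (-(1 : ℝ) / 2) = (b ^ ((1 : ℝ) / 2))⁻¹ := by
      rw [show (-(1 : ℝ) / 2) = -((1 : ℝ) / 2) by norm_num, Real.rpow_neg hb0.le]
    rw [hb32, hbneg]
    have hb12 : 0 < b ^ ((1 : ℝ) / 2) := Real.rpow_pos_of_pos hb0 _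
    field_simp
  calc b * ∫ q, ringDeficit L (fun _ => false) q ^ ((3 : ℝ) / 2) * Real.exp (-b * ringDeficit L (fun _ => false) q) ∂(ringMeasure L)
      ≤ b * (Real.exp 1 * (((3 : ℝ) / 2 * C) * X / b) ^ ((3 : ℝ) / 2) * Z) := mul_le_mul_of_nonneg_left h32 hb0.le
    _ = Real.exp 1 * ((3 : ℝ) / 2 * C) ^ ((3 : ℝ) / 2) * X ^ ((3 : ℝ) / 2) * b ^ (-(1 : ℝ) / 2) * Z := by
        rw [show b * (Real.exp 1 * (((3 : ℝ) / 2 * C) * X / b) ^ ((3 : ℝ) / 2) * Z) =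
          Real.exp 1 * (b * (((3 : ℝ) / 2 * C) * X / b) ^ ((3 : ℝ) / 2)) * Z by ring, e2]
        ring

/-- ★ **CHEBYSHEV TAIL OF THE PERIODIC GIBBS LAW**: ABSOLUTE `C > 0` with, for EVERY `L`, `b ≥ 2`, `s > 0`, `p > 0`,
`∫ 𝟙{s ≤ F₀}·e^{−bF₀} dμ_L ≤ e·(C·p·L⁴·(1 + log L + log b)/(b·s))^p · ∫ e^{−bF₀} dμ_L`. [folklore] -/
theorem periodic_deficit_gibbs_tail_le :
    ∃ C : ℝ, 0 < C ∧ ∀ (L : ℕ) [NeZero L] (b : ℝ), 2 ≤ b → ∀ s : ℝ, 0 < s → ∀ p : ℝ, 0 < p →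
      ∫ q, Set.indicator {q | s ≤ ringDeficit L (fun _ => false) q}
          (fun q => Real.exp (-b * ringDeficit L (fun _ => false) q)) q ∂(ringMeasure L) ≤
        Real.exp 1 * (C * p * (L : ℝ) ^ 4 * (1 + Real.log L + Real.log b) / (b * s)) ^ p *
          ∫ q, Real.exp (-b * ringDeficit L (fun _ => false) q) ∂(ringMeasure L) := by
  obtain ⟨C, hC, h⟩ := periodic_deficit_rpow_moment_le
  refine ⟨C, hC, fun L _ b hb s hs p hp => ?_⟩
  haveI := isProbabilityMeasure_ringMeasure (L := L)
  have hp' := h L b hb p hp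
  have hb0 : 0 < b := by linarith
  set F : ((Fin (2 * L - 1 + 1) → GaugeConfig 3 L SU2) × (Site 3 L → SU2)) → ℝ := ringDeficit L (fun _ => false) with hFdef
  have hF0 : ∀ q, 0 ≤ F q := ringDeficit_nonneg (L := L) _
  obtain ⟨M, hM⟩ := exists_abs_ringDeficit_le (L := L) (fun _ => false)
  have hFm : Measurable F := measurable_ringDeficit _
  have hint : Integrable (fun q => F q ^ p * Real.exp (-b * F q)) (ringMeasure L) := by
    refine Integrable.mono' (integrable_const (M ^ p * Real.exp (b * M)))
      ((hFm.pow_const p).mul (Real.measurable_exp.comp (hFm.const_mul (-b)))).aestronglyMeasurable (ae_of_all _ fun q => ?_)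
    have hFq : F q ≤ M := (le_abs_self _).trans (hM q)
    have hM0 : 0 ≤ M := (hF0 q).trans hFq
    rw [Real.norm_eq_abs, abs_of_nonneg (mul_nonneg (Real.rpow_nonneg (hF0 q) _) (Real.exp_pos _).le)]
    refine mul_le_mul (Real.rpow_le_rpow (hF0 q) hFq hp.le) (Real.exp_le_exp.2 ?_) (Real.exp_pos _).le (by positivity)
    nlinarith [hF0 q, abs_nonneg (F q), hM q]
  have hpt : ∀ q, Set.indicator {q | s ≤ F q} (fun q => Real.exp (-b * F q)) q ≤ s ^ (-p) * (F q ^ p * Real.exp (-b * F q)) := by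
    intro q
    by_cases hq : q ∈ {q | s ≤ F q}
    · rw [Set.indicator_of_mem hq]
      have hsF : s ≤ F q := hq
      have h1 : 1 ≤ s ^ (-p) * F q ^ p := by
        rw [Real.rpow_neg hs.le, ← div_eq_inv_mul, ← Real.div_rpow (hF0 q) hs.le]
        exact Real.one_le_rpow ((one_le_div hs).2 hsF) hp.le
      calc Real.exp (-b * F q) = 1 * Real.exp (-b * F q) := (one_mul _).symm
        _ ≤ (s ^ (-p) * F q ^ p) * Real.exp (-b * F q) := mul_le_mul_of_nonneg_right h1 (Real.exp_pos _).le
        _ = _ := by ring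
    · rw [Set.indicator_of_notMem hq]
      exact mul_nonneg (Real.rpow_nonneg hs.le _) (mul_nonneg (Real.rpow_nonneg (hF0 q) _) (Real.exp_pos _).le)
  calc ∫ q, Set.indicator {q | s ≤ F q} (fun q => Real.exp (-b * F q)) q ∂(ringMeasure L)
      ≤ ∫ q, s ^ (-p) * (F q ^ p * Real.exp (-b * F q)) ∂(ringMeasure L) :=
        integral_mono_of_nonneg (ae_of_all _ fun q => Set.indicator_nonneg (fun _ _ => (Real.exp_pos _).le) _)
          (hint.const_mul _) (ae_of_all _ hpt)
    _ = s ^ (-p) * ∫ q, F q ^ p * Real.exp (-b * F q) ∂(ringMeasure L) := integral_const_mul _ _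
    _ ≤ s ^ (-p) * (Real.exp 1 * (C * p * (L : ℝ) ^ 4 * (1 + Real.log L + Real.log b) / b) ^ p *
          ∫ q, Real.exp (-b * F q) ∂(ringMeasure L)) := mul_le_mul_of_nonneg_left hp' (Real.rpow_nonneg hs.le _)
    _ = Real.exp 1 * (C * p * (L : ℝ) ^ 4 * (1 + Real.log L + Real.log b) / (b * s)) ^ p *
          ∫ q, Real.exp (-b * F q) ∂(ringMeasure L) := by
        have e : (C * p * (L : ℝ) ^ 4 * (1 + Real.log L + Real.log b) / (b * s)) ^ p =
            s ^ (-p) * (C * p * (L : ℝ) ^ 4 * (1 + Real.log L + Real.log b) / b) ^ p := by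
          rw [show C * p * (L : ℝ) ^ 4 * (1 + Real.log L + Real.log b) / (b * s) =
            (C * p * (L : ℝ) ^ 4 * (1 + Real.log L + Real.log b) / b) / s by rw [div_div],
            Real.div_rpow ?_ hs.le, Real.rpow_neg hs.le, div_eq_inv_mul]
          have hL1 : (1 : ℝ) ≤ L := by exact_mod_cast NeZero.one_le
          have := Real.log_nonneg hL1; have := Real.log_nonneg (by linarith : (1:ℝ) ≤ b)
          positivity
        rw [e]; ring

/-- ★★ **ε-FORM ON A WINDOW (periodic)**: for every `q : ℕ` and `ε > 0` there are `a > 0`, `β₂ ≥ 1` such that for `b ≥ β₂` and every `L ≥ 1` with `L ≤ b^a`,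
`b · L^q · ∫ F₀^{3/2} e^{−bF₀} dμ_L ≤ ε · ∫ e^{−bF₀} dμ_L` (✓`window_pow_mul_rpow_le`, `a = 1/(4(q + 8))`). [cite: Griffiths1964] [cite: Luscher1983, §2] -/
theorem periodic_deficit_threeHalves_window (q : ℕ) {ε : ℝ} (hε : 0 < ε) :
    ∃ a : ℝ, 0 < a ∧ ∃ β₂ : ℝ, 1 ≤ β₂ ∧ ∀ (b : ℝ), β₂ ≤ b → ∀ (L : ℕ) [NeZero L], (L : ℝ) ≤ b ^ a →
      b * (L : ℝ) ^ q * ∫ p, ringDeficit L (fun _ => false) p ^ ((3 : ℝ) / 2) * Real.exp (-b * ringDeficit L (fun _ => false) p) ∂(ringMeasure L) ≤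
        ε * ∫ p, Real.exp (-b * ringDeficit L (fun _ => false) p) ∂(ringMeasure L) := by
  obtain ⟨C, hC, h⟩ := periodic_deficit_threeHalves_moment_le
  set a : ℝ := 1 / (4 * ((q : ℝ) + 8)) with hadef
  have hq0 : (0 : ℝ) ≤ q := Nat.cast_nonneg q
  have ha : 0 < a := by rw [hadef]; positivity
  have ha1 : a ≤ 1 := by
    rw [hadef, div_le_one (by positivity)]; nlinarith
  set K : ℝ := C * (3 / a) ^ ((3 : ℝ) / 2) with hKdef
  have hK : 0 < K := by rw [hKdef]; positivity
  have he1 : (1 : ℝ) ≤ Real.exp 1 := by have := Real.add_one_le_exp (1 : ℝ); linarith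
  refine ⟨a, ha, max (max 2 (Real.exp 1)) ((K / ε) ^ 4), le_trans (by norm_num) ((le_max_left _ _).trans (le_max_left _ _)), fun b hb L _ hLb => ?_⟩
  have hb2 : 2 ≤ b := ((le_max_left _ _).trans (le_max_left _ _)).trans hb
  have hbe : Real.exp 1 ≤ b := ((le_max_right _ _).trans (le_max_left _ _)).trans hb
  have hbK : (K / ε) ^ 4 ≤ b := (le_max_right _ _).trans hb
  have hb0 : 0 < b := by linarith
  have hb1 : 1 ≤ b := by linarith
  have hL1 : 1 ≤ L := NeZero.one_le
  set Z : ℝ := ∫ p, Real.exp (-b * ringDeficit L (fun _ => false) p) ∂(ringMeasure L) with hZ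
  have hZ0 : 0 ≤ Z := integral_nonneg fun p => (Real.exp_pos _).le
  have hmain := h L b hb2
  have hwin := window_pow_mul_rpow_le ha ha1 hbe hL1 hLb q
  have hexp : a * (q + 15 / 2) - 1 / 2 ≤ -(1 / 4 : ℝ) := by
    have : a * ((q : ℝ) + 15 / 2) ≤ 1 / 4 := by
      rw [hadef, div_mul_eq_mul_div, one_mul, div_le_iff₀ (by positivity)]; nlinarith
    linarith
  have hb14 : b ^ (a * (q + 15 / 2) - 1 / 2) ≤ b ^ (-(1 / 4 : ℝ)) := Real.rpow_le_rpow_of_exponent_le hb1 hexp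
  have hKε : 0 < K / ε := div_pos hK hε
  have hb4 : K / ε ≤ b ^ ((1 : ℝ) / 4) := by
    have h1 : ((K / ε) ^ 4) ^ ((1 : ℝ) / 4) ≤ b ^ ((1 : ℝ) / 4) := Real.rpow_le_rpow (by positivity) hbK (by norm_num)
    have h2 : ((K / ε) ^ 4) ^ ((1 : ℝ) / 4) = K / ε := by
      rw [← Real.rpow_natCast, ← Real.rpow_mul hKε.le]; norm_num
    rwa [h2] at h1
  have hbinv : b ^ (-(1 / 4 : ℝ)) ≤ ε / K := by
    rw [show (-(1 / 4 : ℝ)) = -((1 : ℝ) / 4) by norm_num, Real.rpow_neg hb0.le]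
    rw [inv_le_comm₀ (Real.rpow_pos_of_pos hb0 _) (div_pos hε hK), inv_div]
    exact hb4
  have hLq : (0 : ℝ) ≤ (L : ℝ) ^ q := by positivity
  calc b * (L : ℝ) ^ q * ∫ p, ringDeficit L (fun _ => false) p ^ ((3 : ℝ) / 2) *
          Real.exp (-b * ringDeficit L (fun _ => false) p) ∂(ringMeasure L)
      = (L : ℝ) ^ q * (b * ∫ p, ringDeficit L (fun _ => false) p ^ ((3 : ℝ) / 2) *
          Real.exp (-b * ringDeficit L (fun _ => false) p) ∂(ringMeasure L)) := by ring
    _ ≤ (L : ℝ) ^ q * (C * ((L : ℝ) ^ 4 * (1 + Real.log L + Real.log b)) ^ ((3 : ℝ) / 2) * b ^ (-(1 : ℝ) / 2) * Z) :=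
        mul_le_mul_of_nonneg_left hmain hLq
    _ = C * ((L : ℝ) ^ q * ((L : ℝ) ^ 4 * (1 + Real.log L + Real.log b)) ^ ((3 : ℝ) / 2) * b ^ (-(1 : ℝ) / 2)) * Z := by ring
    _ ≤ C * ((3 / a) ^ ((3 : ℝ) / 2) * b ^ (a * (q + 15 / 2) - 1 / 2)) * Z :=
        mul_le_mul_of_nonneg_right (mul_le_mul_of_nonneg_left hwin hC.le) hZ0
    _ = K * b ^ (a * (q + 15 / 2) - 1 / 2) * Z := by rw [hKdef]; ring
    _ ≤ K * (ε / K) * Z := mul_le_mul_of_nonneg_right (mul_le_mul_of_nonneg_left (hb14.trans hbinv) hK.le) hZ0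
    _ = ε * Z := by field_simp

end Summit.QuantumFields.YangMills.Theorems.SwapVirialDeficit.PeriodicRing

end
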